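/-
Copyright (c) 2026 the pub-hodgecm-mathlib formalisation cell (harness21).  Prover seat hodgecm-mathlib-K2E4-p10 (g10), Track B «K2-LIT»,
#184♮ = hLiu418 = `stmt-HodgeConjecture-24832`; socket #41, KIND 1 — (m2) HEIGHT BOUNDS ON THE HERMITIAN TUBE AT THE BASE POINT: the denominator
`denom(P, i1)`, its inverse and determinant, and `V = Im(P·i1)` (above AND below) against an entry bound of `P ∈ U(J)` (K1a desk K2Liu-p01 (g11) WORD #5 (b),
2026-09-05T02:15:39Z; consumer K2Liu-p03 (g8) (m1)(m3) → ★ p864498's `hgauss`∕`hP`).  THEOREMS ONLY (no `def`, no `instance`, no notation, no named-fact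
hypothesis, no `sorry`).
-/
import Summits.HodgeConjecture.HodgeConjecture.Theorems.K2LiuArchBlockHeightBound      -- ★ `norm_mul_apply_le`, `norm_det_le_of_entry_le`, `posSemidef_mul_conjTranspose_sub_smul`
import Summits.HodgeConjecture.HodgeConjecture.Theorems.K2LiuHermitianTubeCocycle      -- ★ `conjTranspose_denom_mul_num_sub`, `…_im_moeb_mul_denom`, `isUnit_det_denom`, `im_I_smul_one`
import HarnessLib

/-!
# Crux `HLiu418`, socket #41, KIND 1 — (m2) `K2LiuArchSiegelHalfSpaceHeightBounds`: `denom(P, i·1)^{±1}`, `det denom(P, i·1)^{±1}` and `Im(P·(i·1))^{±1}`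
# against the entries of `P ∈ U(J)` — all from ONE ℓ¹ key lemma

Cell `hodgecm-mathlib`, crux item hLiu418 = `stmt-HodgeConjecture-24832` (helper lane `--supports … --as helper`, count-neutral), route of record `HCCMUnconditional`;
squad K2 ∕ K2Liu, road `K2_Liu`, socket #41, KIND 1 a♮; K1a desk K2Liu-p01 (g11) (deputy: this seat).  Consumer: K2Liu-p03 (g8)'s (m1) «Levi-translate Gaussian parameter
`p_w((Λ(γ)·h)_∞) = 2·Re(γ_w V_w(h) γ_wᴴ)₁₁`» and (m3), feeding ★ p864498 `hAcb_of_archLetters`' dictionary letters (v) `hP` (prefactors `≤ C·H^a·…`) and (vi) `hgauss`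
(`b₀·H^{−a′₀}·τa ≤ Σ_w g_w`): they need `λ_min(V_w(h)) ≥ c·H(h)^{−a′}` and `‖V_w‖, (det V_w)^{∓1}, |det denom(h_w, i1)|^{±1} ≤ C·H(h)^b`, where
`V(P) := (2i)⁻¹(P·(i1) − (P·(i1))ᴴ)` (C131-p02's ★ p864004 spelling) and the entries of `h_w = archAt w (archPart h)` are `≤ H(h)` (★ `norm_archAt_archPart_apply_le`).
THE MATHEMATICS (elementary; [Shimura1997, §6.2–6.3]; the `SL₂` fact `c² + d² ≥ ‖g‖^{−2}` in disguise).  For `P = (A B; C D) ∈ U(J)` with all entries `≤ R`, put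
`M := denom(P, i1) = iC + D`, `N := num(P, i1) = iA + B` (entries `≤ 2R`).  ★ `conjTranspose_denom_mul_num_sub` at `Z = i1` reads `Mᴴ N − Nᴴ M = 2i·1`, so for every
vector `y`: `2‖y‖₂² = |⟨My, Ny⟩ − ⟨Ny, My⟩| ≤ 2·‖My‖₁·max_j |(Ny)_j| ≤ 4R·‖y‖₁·‖My‖₁`, and with `‖y‖₁² ≤ m·‖y‖₂²`: **`‖y‖₁ ≤ 2mR·‖My‖₁`** (§1, `sum_norm_le_of_denom_I`).
Consequences (§2–§3, `m := |l|`): entries of `M⁻¹` are `≤ 2mR`; `|det M| ≤ m!(2R)^m`, `|det M|⁻¹ ≤ m!(2mR)^m`; `V = M⁻ᴴM⁻¹` (★ `conjTranspose_denom_mul_im_moeb_mul_denom` +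
★ `im_I_smul_one`) has entries `≤ m(2mR)²`, `V − (2mR)^{−2}·1 ⪰ 0` (★ `posSemidef_mul_conjTranspose_sub_smul` with `y := M⁻ᴴ`, `z := Mᴴ`) — read as
`(2mR)^{−2}·Σ|v_i|² ≤ Re(vᴴ V v)` —, `|det V| ≤ (m!(2mR)^m)²`, `|det V|⁻¹ ≤ (m!(2R)^m)²`.  All FRAME-FREE in an abstract entry bound `R`; the consumer sets
`R := C_T·H(h)^a` from ★ `norm_archAt_archPart_apply_le` and its Levi-translate chain.
[Shimura1997, §6.2–6.3], [BorelJacquet1979, §1.2, §4.1], [MoeglinWaldspurger1995, I.2.2].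
HONEST LABEL.  Elementary matrix inequalities, count-neutral; they close no socket: `HC_CM` is proved only modulo the 7 printed citations (2 remaining named inputs:
hLiu418 = `stmt-HodgeConjecture-24832`, h413 = `stmt-HodgeConjecture-24833`) until rung 0 closes.
-/

set_option autoImplicit false
set_option linter.dupNamespace false -- the mandated namespace repeats `HodgeConjecture.HodgeConjecture`

noncomputable section

open scoped ComplexOrder Matrix
open Complex Matrix Finset

namespace Summit.HodgeConjecture.HodgeConjecture.Cruxes.HLiu418.K2LiuArchSiegelHalfSpaceHeightBounds

open Literature.NumberTheory.ModularForms.SiegelUpperHalfSpace (num denom moeb num_def denom_def)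
open Summit.HodgeConjecture.HodgeConjecture.Cruxes.HLiu418.K2LiuArchBlockHeightBound (norm_mul_apply_le norm_det_le_of_entry_le posSemidef_mul_conjTranspose_sub_smul)
open Summit.HodgeConjecture.HodgeConjecture.Cruxes.HLiu418.K2LiuHermitianTubeCocycle (conjTranspose_denom_mul_num_sub conjTranspose_denom_mul_im_moeb_mul_denom
  isUnit_det_denom sub_conjTranspose_eq_smul_im im_I_smul_one posDef_im_I_smul_one)

variable {l : Type*} [Fintype l] [DecidableEq l]

/-! ## §1 Entries of `denom`, `num` at the base point, the identity `Mᴴ N − Nᴴ M = 2i·1`, and the ℓ¹ key lemma -/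

/-- `(denom(P, i1))_{ij} = i·C_{ij} + D_{ij}` has norm `≤ 2R` when the entries of `P` are `≤ R`. [folklore] -/
theorem norm_denom_I_apply_le {P : Matrix (l ⊕ l) (l ⊕ l) ℂ} {R : ℝ} (hR : ∀ i j, ‖P i j‖ ≤ R) (i j : l) :
    ‖denom P (I • (1 : Matrix l l ℂ)) i j‖ ≤ 2 * R := by
  rw [denom_def, Matrix.mul_smul, Matrix.mul_one, Matrix.add_apply, Matrix.smul_apply, smul_eq_mul]
  calc ‖I * P.toBlocks₂₁ i j + P.toBlocks₂₂ i j‖ ≤ ‖I * P.toBlocks₂₁ i j‖ + ‖P.toBlocks₂₂ i j‖ := norm_add_le _ _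
    _ ≤ R + R := by
        rw [norm_mul, Complex.norm_I, one_mul]
        exact add_le_add (hR (Sum.inr i) (Sum.inl j)) (hR (Sum.inr i) (Sum.inr j))
    _ = 2 * R := by ring

/-- `(num(P, i1))_{ij} = i·A_{ij} + B_{ij}` has norm `≤ 2R` when the entries of `P` are `≤ R`. [folklore] -/
theorem norm_num_I_apply_le {P : Matrix (l ⊕ l) (l ⊕ l) ℂ} {R : ℝ} (hR : ∀ i j, ‖P i j‖ ≤ R) (i j : l) :
    ‖num P (I • (1 : Matrix l l ℂ)) i j‖ ≤ 2 * R := by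
  rw [num_def, Matrix.mul_smul, Matrix.mul_one, Matrix.add_apply, Matrix.smul_apply, smul_eq_mul]
  calc ‖I * P.toBlocks₁₁ i j + P.toBlocks₁₂ i j‖ ≤ ‖I * P.toBlocks₁₁ i j‖ + ‖P.toBlocks₁₂ i j‖ := norm_add_le _ _
    _ ≤ R + R := by
        rw [norm_mul, Complex.norm_I, one_mul]
        exact add_le_add (hR (Sum.inl i) (Sum.inl j)) (hR (Sum.inl i) (Sum.inr j))
    _ = 2 * R := by ring

/-- **`Mᴴ N − Nᴴ M = 2i·1`** at the base point (`M = denom(P, i1)`, `N = num(P, i1)`, `P ∈ U(J)`): ★ `conjTranspose_denom_mul_num_sub` at `Z = i1`, where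
`Z − Zᴴ = 2i·1`. [cite: Shimura1997, §6.2] -/
theorem conjTranspose_denom_mul_num_sub_I {P : Matrix (l ⊕ l) (l ⊕ l) ℂ} (hP : Pᴴ * Matrix.J l ℂ * P = Matrix.J l ℂ) :
    (denom P (I • (1 : Matrix l l ℂ)))ᴴ * num P (I • (1 : Matrix l l ℂ)) - (num P (I • (1 : Matrix l l ℂ)))ᴴ * denom P (I • (1 : Matrix l l ℂ)) =
      (2 * I) • (1 : Matrix l l ℂ) := by
  rw [conjTranspose_denom_mul_num_sub hP, sub_conjTranspose_eq_smul_im, im_I_smul_one]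

omit [DecidableEq l] in
/-- `‖Σ_j conj(u_j)·w_j‖ ≤ Σ_j ‖u_j‖·‖w_j‖`. [folklore] -/
theorem norm_star_dotProduct_le (u w : l → ℂ) : ‖star u ⬝ᵥ w‖ ≤ ∑ j, ‖u j‖ * ‖w j‖ := by
  rw [dotProduct]
  refine (norm_sum_le _ _).trans (Finset.sum_le_sum fun j _ => ?_)
  rw [Pi.star_apply, norm_mul, norm_star]

omit [DecidableEq l] in
/-- an entry of `X *ᵥ y` against the ℓ¹ norm of `y`: `‖(Xy)_j‖ ≤ a·Σ_k ‖y_k‖` when the entries of `X` are `≤ a`. [folklore] -/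
theorem norm_mulVec_apply_le {X : Matrix l l ℂ} {a : ℝ} (hX : ∀ i j, ‖X i j‖ ≤ a) (y : l → ℂ) (j : l) :
    ‖(X *ᵥ y) j‖ ≤ a * ∑ k, ‖y k‖ := by
  rw [Matrix.mulVec, dotProduct, Finset.mul_sum]
  refine (norm_sum_le _ _).trans (Finset.sum_le_sum fun k _ => ?_)
  rw [norm_mul]
  exact mul_le_mul_of_nonneg_right (hX j k) (norm_nonneg _)

omit [DecidableEq l] in
/-- `vᴴ v = Σ ‖v_i‖²` as a real number cast to `ℂ`. [folklore] -/
theorem star_dotProduct_self_eq (v : l → ℂ) : star v ⬝ᵥ v = ((∑ i, ‖v i‖ ^ 2 : ℝ) : ℂ) := by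
  rw [dotProduct, Complex.ofReal_sum]
  refine Finset.sum_congr rfl fun i _ => ?_
  rw [Pi.star_apply, Complex.star_def, Complex.conj_mul', Complex.ofReal_pow]

/-- **THE ℓ¹ KEY LEMMA**: for `P ∈ U(J)` with entries `≤ R` and `M = denom(P, i1)`, every vector satisfies `Σ_i ‖y_i‖ ≤ 2·m·R·Σ_i ‖(My)_i‖` (`m = |l|`).
From `Mᴴ N − Nᴴ M = 2i·1`: `2‖y‖₂² ≤ 2·(2R‖y‖₁)·‖My‖₁` and `‖y‖₁² ≤ m‖y‖₂²`. [cite: Shimura1997, §6.3] [cite: BorelJacquet1979, §1.2] -/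
theorem sum_norm_le_of_denom_I {P : Matrix (l ⊕ l) (l ⊕ l) ℂ} (hP : Pᴴ * Matrix.J l ℂ * P = Matrix.J l ℂ) {R : ℝ} (hR : ∀ i j, ‖P i j‖ ≤ R)
    (y : l → ℂ) :
    ∑ i, ‖y i‖ ≤ 2 * (Fintype.card l) * R * ∑ i, ‖(denom P (I • (1 : Matrix l l ℂ)) *ᵥ y) i‖ := by
  have hnumR := norm_num_I_apply_le (P := P) hR
  have hid := conjTranspose_denom_mul_num_sub_I hP
  set M : Matrix l l ℂ := denom P (I • (1 : Matrix l l ℂ)) with hM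
  set N : Matrix l l ℂ := num P (I • (1 : Matrix l l ℂ)) with hN
  set s : ℝ := ∑ i, ‖y i‖ with hs
  set T : ℝ := ∑ i, ‖(M *ᵥ y) i‖ with hT
  have hs0 : 0 ≤ s := Finset.sum_nonneg fun _ _ => norm_nonneg _
  have hT0 : 0 ≤ T := Finset.sum_nonneg fun _ _ => norm_nonneg _
  -- the quadratic identity `2i·‖y‖₂² = (My)ᴴ(Ny) − (Ny)ᴴ(My)`
  have e1 : star y ⬝ᵥ (Mᴴ *ᵥ (N *ᵥ y)) = star (M *ᵥ y) ⬝ᵥ (N *ᵥ y) := by rw [Matrix.dotProduct_mulVec, Matrix.star_mulVec]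
  have e2 : star y ⬝ᵥ (Nᴴ *ᵥ (M *ᵥ y)) = star (N *ᵥ y) ⬝ᵥ (M *ᵥ y) := by rw [Matrix.dotProduct_mulVec, Matrix.star_mulVec]
  have hq : (2 * I) * (star y ⬝ᵥ y) = star (M *ᵥ y) ⬝ᵥ (N *ᵥ y) - star (N *ᵥ y) ⬝ᵥ (M *ᵥ y) := by
    have h := congrArg (fun A : Matrix l l ℂ => star y ⬝ᵥ (A *ᵥ y)) hid
    rw [Matrix.smul_mulVec, Matrix.one_mulVec, dotProduct_smul, smul_eq_mul, Matrix.sub_mulVec, dotProduct_sub, ← Matrix.mulVec_mulVec,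
      ← Matrix.mulVec_mulVec, e1, e2] at h
    exact h.symm
  -- norms: `2·Σ‖y_i‖² ≤ 2·(2R·s)·T`
  have hNy : ∀ j, ‖(N *ᵥ y) j‖ ≤ 2 * R * s := fun j => norm_mulVec_apply_le hnumR y j
  have h2 : 2 * ∑ i, ‖y i‖ ^ 2 ≤ 2 * ((2 * R * s) * T) := by
    have hl : ‖(2 * I) * (star y ⬝ᵥ y)‖ = 2 * ∑ i, ‖y i‖ ^ 2 := by
      rw [star_dotProduct_self_eq, norm_mul, norm_mul, Complex.norm_I, Complex.norm_real, Real.norm_of_nonneg (Finset.sum_nonneg fun _ _ => sq_nonneg _)]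
      norm_num
    have hb : ∀ u w : l → ℂ, (∀ j, ‖w j‖ ≤ 2 * R * s) → ‖star u ⬝ᵥ w‖ ≤ (2 * R * s) * ∑ j, ‖u j‖ := fun u w hw =>
      (norm_star_dotProduct_le u w).trans (by
        rw [Finset.mul_sum]
        exact Finset.sum_le_sum fun j _ => by rw [mul_comm]; exact mul_le_mul_of_nonneg_right (hw j) (norm_nonneg _))
    have hb' : ‖star (N *ᵥ y) ⬝ᵥ (M *ᵥ y)‖ ≤ (2 * R * s) * T := by
      rw [Matrix.star_dotProduct, norm_star]
      exact hb _ _ hNy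
    rw [← hl, hq]
    exact (norm_sub_le _ _).trans (by linarith [hb (M *ᵥ y) (N *ᵥ y) hNy])
  -- Chebyshev: `s² ≤ m·Σ‖y_i‖²`
  have hch : s ^ 2 ≤ (Fintype.card l : ℝ) * ∑ i, ‖y i‖ ^ 2 := by
    have := sq_sum_le_card_mul_sum_sq (s := (Finset.univ : Finset l)) (f := fun i => ‖y i‖)
    rwa [Finset.card_univ] at this
  have hm0 : (0 : ℝ) ≤ Fintype.card l := Nat.cast_nonneg _
  have hss : s * s ≤ s * (2 * (Fintype.card l) * R * T) := by nlinarith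
  rcases hs0.eq_or_lt with h0 | hpos
  · -- `y = 0` in ℓ¹: both sides vanish or the right side is non-negative (`R ≥ 0` as soon as `l` is non-empty)
    rw [← h0]
    rcases isEmpty_or_nonempty l with hl | ⟨⟨i⟩⟩
    · simp [hT]
    · exact mul_nonneg (mul_nonneg (by positivity) ((norm_nonneg _).trans (hR (Sum.inl i) (Sum.inl i)))) hT0
  · exact le_of_mul_le_mul_left hss hpos

/-! ## §2 The denominator: its inverse and its determinant -/

/-- **entries of `denom(P, i1)⁻¹` are `≤ 2mR`** (the key lemma on the columns `M⁻¹e_j`). [cite: Shimura1997, §6.3] -/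
theorem norm_inv_denom_I_apply_le {P : Matrix (l ⊕ l) (l ⊕ l) ℂ} (hP : Pᴴ * Matrix.J l ℂ * P = Matrix.J l ℂ) {R : ℝ} (hR : ∀ i j, ‖P i j‖ ≤ R)
    (i j : l) :
    ‖(denom P (I • (1 : Matrix l l ℂ)))⁻¹ i j‖ ≤ 2 * (Fintype.card l) * R := by
  set M : Matrix l l ℂ := denom P (I • (1 : Matrix l l ℂ)) with hM
  have hdet : IsUnit M.det := isUnit_det_denom hP posDef_im_I_smul_one
  have hkey := sum_norm_le_of_denom_I hP hR (M⁻¹ *ᵥ Pi.single j 1)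
  rw [Matrix.mulVec_mulVec, Matrix.mul_nonsing_inv _ hdet, Matrix.one_mulVec] at hkey
  have hcol : ∀ k, (M⁻¹ *ᵥ Pi.single j 1) k = M⁻¹ k j := fun k => by rw [Matrix.mulVec_single_one]; rfl
  have h1 : ∑ k, ‖(Pi.single j (1 : ℂ) : l → ℂ) k‖ = 1 := by
    rw [Finset.sum_eq_single j (fun k _ hk => by rw [Pi.single_eq_of_ne hk, norm_zero]) (fun h => (h (Finset.mem_univ j)).elim),
      Pi.single_eq_same, norm_one]
  rw [h1, mul_one] at hkey
  calc ‖M⁻¹ i j‖ = ‖(M⁻¹ *ᵥ Pi.single j 1) i‖ := by rw [hcol]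
    _ ≤ ∑ k, ‖(M⁻¹ *ᵥ Pi.single j 1) k‖ := Finset.single_le_sum (f := fun k => ‖(M⁻¹ *ᵥ Pi.single j 1) k‖) (fun _ _ => norm_nonneg _) (Finset.mem_univ i)
    _ ≤ 2 * (Fintype.card l) * R := hkey

/-- `|det denom(P, i1)| ≤ m!·(2R)^m`. [folklore] -/
theorem norm_det_denom_I_le {P : Matrix (l ⊕ l) (l ⊕ l) ℂ} {R : ℝ} (hR : ∀ i j, ‖P i j‖ ≤ R) :
    ‖(denom P (I • (1 : Matrix l l ℂ))).det‖ ≤ (Fintype.card l).factorial * (2 * R) ^ Fintype.card l :=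
  norm_det_le_of_entry_le (norm_denom_I_apply_le hR)

/-- **`|det denom(P, i1)|⁻¹ ≤ m!·(2mR)^m`** (`det M⁻¹ = (det M)⁻¹` and §2's entry bound). [cite: Shimura1997, §6.3] -/
theorem norm_det_denom_I_inv_le {P : Matrix (l ⊕ l) (l ⊕ l) ℂ} (hP : Pᴴ * Matrix.J l ℂ * P = Matrix.J l ℂ) {R : ℝ} (hR : ∀ i j, ‖P i j‖ ≤ R) :
    ‖((denom P (I • (1 : Matrix l l ℂ))).det)⁻¹‖ ≤ (Fintype.card l).factorial * (2 * (Fintype.card l) * R) ^ Fintype.card l := by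
  have hdet : IsUnit (denom P (I • (1 : Matrix l l ℂ))).det := isUnit_det_denom hP posDef_im_I_smul_one
  have h := norm_det_le_of_entry_le (norm_inv_denom_I_apply_le hP hR)
  rwa [Matrix.det_nonsing_inv, Ring.inverse_eq_inv'] at h

/-! ## §3 `V = Im(P·(i1))`: the formula `V = M⁻ᴴ M⁻¹`, entries, the positive floor, the determinant -/

/-- **`Im(P·(i1)) = (denomᴴ)⁻¹ · denom⁻¹`** (★ `(CZ+D)ᴴ·Im(P·Z)·(CZ+D) = Im Z` at `Z = i1`, `Im(i1) = 1`). [cite: Shimura1997, §6.3] -/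
theorem im_moeb_I_eq {P : Matrix (l ⊕ l) (l ⊕ l) ℂ} (hP : Pᴴ * Matrix.J l ℂ * P = Matrix.J l ℂ) :
    (2 * I)⁻¹ • (moeb P (I • (1 : Matrix l l ℂ)) - (moeb P (I • (1 : Matrix l l ℂ)))ᴴ) =
      ((denom P (I • (1 : Matrix l l ℂ)))ᴴ)⁻¹ * (denom P (I • (1 : Matrix l l ℂ)))⁻¹ := by
  set M : Matrix l l ℂ := denom P (I • (1 : Matrix l l ℂ)) with hM
  set V : Matrix l l ℂ := (2 * I)⁻¹ • (moeb P (I • (1 : Matrix l l ℂ)) - (moeb P (I • (1 : Matrix l l ℂ)))ᴴ) with hV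
  have hdet : IsUnit M.det := isUnit_det_denom hP posDef_im_I_smul_one
  have hdetH : IsUnit Mᴴ.det := by rw [Matrix.det_conjTranspose]; exact hdet.star
  have h := conjTranspose_denom_mul_im_moeb_mul_denom hP (Z := I • (1 : Matrix l l ℂ)) posDef_im_I_smul_one
  rw [im_I_smul_one] at h
  -- `Mᴴ V M = 1` ⇒ `V = (Mᴴ)⁻¹ M⁻¹`
  calc V = (Mᴴ)⁻¹ * (Mᴴ * V * M) * M⁻¹ := by
        rw [Matrix.mul_assoc (Mᴴ), ← Matrix.mul_assoc (Mᴴ)⁻¹, Matrix.nonsing_inv_mul _ hdetH, Matrix.one_mul, Matrix.mul_assoc,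
          Matrix.mul_nonsing_inv _ hdet, Matrix.mul_one]
    _ = (Mᴴ)⁻¹ * M⁻¹ := by rw [h, Matrix.mul_one]

/-- **entries of `V = Im(P·(i1))` are `≤ m·(2mR)²`**. [cite: Shimura1997, §6.3] [cite: BorelJacquet1979, §1.2] -/
theorem norm_im_moeb_I_apply_le {P : Matrix (l ⊕ l) (l ⊕ l) ℂ} (hP : Pᴴ * Matrix.J l ℂ * P = Matrix.J l ℂ) {R : ℝ} (hR : ∀ i j, ‖P i j‖ ≤ R)
    (i j : l) :
    ‖((2 * I)⁻¹ • (moeb P (I • (1 : Matrix l l ℂ)) - (moeb P (I • (1 : Matrix l l ℂ)))ᴴ)) i j‖ ≤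
      (Fintype.card l) * (2 * (Fintype.card l) * R) ^ 2 := by
  rw [im_moeb_I_eq hP]
  have hinv := norm_inv_denom_I_apply_le hP hR
  have hinvH : ∀ i j, ‖((denom P (I • (1 : Matrix l l ℂ)))ᴴ)⁻¹ i j‖ ≤ 2 * (Fintype.card l) * R := fun i j => by
    rw [← Matrix.conjTranspose_nonsing_inv, Matrix.conjTranspose_apply, norm_star]
    exact hinv j i
  have hR0 : 0 ≤ 2 * (Fintype.card l : ℝ) * R := (norm_nonneg _).trans (hinv i j)
  calc _ ≤ (Fintype.card l) * ((2 * (Fintype.card l) * R) * (2 * (Fintype.card l) * R)) := norm_mul_apply_le hR0 hinvH hinv i j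
    _ = (Fintype.card l) * (2 * (Fintype.card l) * R) ^ 2 := by ring

/-- **THE POSITIVE FLOOR OF `Im(P·(i1))`**: `V − ((m·2R)²)⁻¹·1 ⪰ 0` (★ `posSemidef_mul_conjTranspose_sub_smul` with `y := (Mᴴ)⁻¹`, `z := Mᴴ`, entries of `z` `≤ 2R`).
[cite: Shimura1997, §6.3] [cite: BorelJacquet1979, §1.2, §4.1] -/
theorem im_moeb_I_sub_smul_posSemidef {P : Matrix (l ⊕ l) (l ⊕ l) ℂ} (hP : Pᴴ * Matrix.J l ℂ * P = Matrix.J l ℂ) {R : ℝ} (hR : ∀ i j, ‖P i j‖ ≤ R) :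
    ((2 * I)⁻¹ • (moeb P (I • (1 : Matrix l l ℂ)) - (moeb P (I • (1 : Matrix l l ℂ)))ᴴ) -
      (((((Fintype.card l : ℝ) * (2 * R)) ^ 2)⁻¹ : ℝ) : ℂ) • (1 : Matrix l l ℂ)).PosSemidef := by
  set M : Matrix l l ℂ := denom P (I • (1 : Matrix l l ℂ)) with hM
  have hdet : IsUnit M.det := isUnit_det_denom hP posDef_im_I_smul_one
  have hdetH : IsUnit Mᴴ.det := by rw [Matrix.det_conjTranspose]; exact hdet.star
  have hyz : (Mᴴ)⁻¹ * Mᴴ = 1 := Matrix.nonsing_inv_mul _ hdetH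
  have hz : ∀ i j, ‖Mᴴ i j‖ ≤ 2 * R := fun i j => by rw [Matrix.conjTranspose_apply, norm_star]; exact norm_denom_I_apply_le hR j i
  have h := posSemidef_mul_conjTranspose_sub_smul hyz hz
  rw [← Matrix.conjTranspose_nonsing_inv, Matrix.conjTranspose_conjTranspose] at h
  rw [im_moeb_I_eq hP, ← Matrix.conjTranspose_nonsing_inv]
  exact h

/-- **`λ_min(Im(P·(i1))) ≥ (2mR)^{−2}` AS A QUADRATIC FORM**: `((m·2R)²)⁻¹·Σ_i ‖v_i‖² ≤ Re(vᴴ·V·v)` for every `v`. [cite: Shimura1997, §6.3] -/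
theorem re_star_dotProduct_im_moeb_I_mulVec_ge {P : Matrix (l ⊕ l) (l ⊕ l) ℂ} (hP : Pᴴ * Matrix.J l ℂ * P = Matrix.J l ℂ) {R : ℝ}
    (hR : ∀ i j, ‖P i j‖ ≤ R) (v : l → ℂ) :
    (((Fintype.card l : ℝ) * (2 * R)) ^ 2)⁻¹ * ∑ i, ‖v i‖ ^ 2 ≤
      (star v ⬝ᵥ (((2 * I)⁻¹ • (moeb P (I • (1 : Matrix l l ℂ)) - (moeb P (I • (1 : Matrix l l ℂ)))ᴴ)) *ᵥ v)).re := by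
  have h := (im_moeb_I_sub_smul_posSemidef hP hR).dotProduct_mulVec_nonneg v
  rw [Matrix.sub_mulVec, dotProduct_sub, Matrix.smul_mulVec _ (1 : Matrix l l ℂ) v, Matrix.one_mulVec, dotProduct_smul, smul_eq_mul, star_dotProduct_self_eq,
    ← Complex.ofReal_mul, Complex.le_def, Complex.sub_re, Complex.ofReal_re, Complex.zero_re, sub_nonneg] at h
  exact h.1

/-- `|det Im(P·(i1))| ≤ (m!·(2mR)^m)²`. [folklore] -/
theorem norm_det_im_moeb_I_le {P : Matrix (l ⊕ l) (l ⊕ l) ℂ} (hP : Pᴴ * Matrix.J l ℂ * P = Matrix.J l ℂ) {R : ℝ} (hR : ∀ i j, ‖P i j‖ ≤ R) :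
    ‖((2 * I)⁻¹ • (moeb P (I • (1 : Matrix l l ℂ)) - (moeb P (I • (1 : Matrix l l ℂ)))ᴴ)).det‖ ≤
      ((Fintype.card l).factorial * (2 * (Fintype.card l) * R) ^ Fintype.card l) ^ 2 := by
  have hinv := norm_inv_denom_I_apply_le hP hR
  have hinvH : ∀ i j, ‖((denom P (I • (1 : Matrix l l ℂ)))ᴴ)⁻¹ i j‖ ≤ 2 * (Fintype.card l) * R := fun i j => by
    rw [← Matrix.conjTranspose_nonsing_inv, Matrix.conjTranspose_apply, norm_star]
    exact hinv j i
  rw [im_moeb_I_eq hP, Matrix.det_mul, norm_mul, sq]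
  exact mul_le_mul (norm_det_le_of_entry_le hinvH) (norm_det_le_of_entry_le hinv) (norm_nonneg _)
    ((norm_nonneg _).trans (norm_det_le_of_entry_le hinvH))

/-- **`|det Im(P·(i1))|⁻¹ = |det denom(P, i1)|² ≤ (m!·(2R)^m)²`**. [cite: Shimura1997, §6.3] -/
theorem inv_norm_det_im_moeb_I_le {P : Matrix (l ⊕ l) (l ⊕ l) ℂ} (hP : Pᴴ * Matrix.J l ℂ * P = Matrix.J l ℂ) {R : ℝ} (hR : ∀ i j, ‖P i j‖ ≤ R) :
    ‖((2 * I)⁻¹ • (moeb P (I • (1 : Matrix l l ℂ)) - (moeb P (I • (1 : Matrix l l ℂ)))ᴴ)).det‖⁻¹ ≤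
      ((Fintype.card l).factorial * (2 * R) ^ Fintype.card l) ^ 2 := by
  have hdet : IsUnit (denom P (I • (1 : Matrix l l ℂ))).det := isUnit_det_denom hP posDef_im_I_smul_one
  have hM := norm_det_denom_I_le (P := P) hR
  rw [im_moeb_I_eq hP, Matrix.det_mul, Matrix.det_nonsing_inv, Matrix.det_nonsing_inv, Ring.inverse_eq_inv',
    Matrix.det_conjTranspose, norm_mul, norm_inv, norm_inv, norm_star, ← mul_inv, inv_inv, sq]
  exact mul_le_mul hM hM (norm_nonneg _) ((norm_nonneg _).trans hM)

end Summit.HodgeConjecture.HodgeConjecture.Cruxes.HLiu418.K2LiuArchSiegelHalfSpaceHeightBounds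

end
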